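import Literature.NumberTheory.LFunctions.GeneralizedRH
import Literature.Barriers.Parity.PrimeLevelTransitionZeroFreeBox

/-!
# Route `PrimeLevelFamEdge` — TYPED IDEA DELTAS, deck 30 (LANDING NOTE typer ls-idea-typ-1 gen 4: lens-20 g11's
# `HOME/ls-idea-lens-20/g11/Sketch_L20t_RStarDichotomy.lean` sha16 9f67cea84f355ccd VERBATIM up to namespace
# `…Theses.PrimeLevelFamEdge.LensTwentySketchT` → `…Theorems.PrimeLevelFamEdgeIdeaDeltas.RStarDichotomy`; card K-L20-6 rev 3.2;
# desk NOTICE l.2977 priority (i); critic E of record: Q-SIGN-1 RULING l.2993 names this sketch sha as the file of record (byte copy rc 0,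
# axioms std, planted-false ×2 rc 1; kernel logic of record `quasiRH_or_tameBad_or_wildBad`, `clauseIO_of_not_wildBad`, `wildBad_of_not_clauseIO`,
# `quasiRH_or_wildBad_of_clauseEventually(Abs)` — the Ω-inputs are HYPOTHESES on r); two docstrings added (lint).)
#
# Lens-20 (negation) gen 11 — the R⋆ trichotomy, TYPED (kernel piece for rev 3.2 §R of crux idea
`l20-l6-principal-sqrt-barrier` on `stmt-Parity-20343`, node L5′ ≡ U, band R⋆)

What is PROVED here is ORDER / SET / FILTER LOGIC over the tree's `QuasiRiemannHypothesis`: the three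
WORLDS (quasi-RH(θ) | TAME bad | WILD bad) are exhaustive and pairwise exclusive, a tame bad world has an
ATTAINED worst zero, a creeping supremum is wild, and the R⋆-clause bookkeeping follows from three analytic
INPUTS that enter as HYPOTHESES on an abstract normalised aggregate `r : ℝ → ℝ` (pencil: `r N = R⋆(N)/𝔪(N)`):
`hSuff` = lens-5 §1 sufficiency (quasi-RH(θ) ⇒ clause at all large scales); `hSign` = the Landau–
Montgomery–Vaughan Ω₋ comparison (MV2007 Thm 15.3 / (15.12) shape: a tame bad world forces `r N < 0`
infinitely often); `hOmegaPlus` / `hOmegaAbs` = the Ω₊ / Ω companions (MV2007 Thm 15.2–15.3 shape).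
Nothing about `ζ`, `K_B`, the heart stub or any bound on U / R⋆ is proved here. HONESTY: typed ≠ proved.
-/

namespace Summit.Parity.GeneralizedHardyLittlewood.Theorems.PrimeLevelFamEdgeIdeaDeltas.RStarDichotomy

open Filter Literature.NumberTheory.LFunctions

/-- A zero of `ζ` in the critical strip strictly beyond the abscissa `θ`. -/
def ZeroBeyond (θ : ℝ) (ρ : ℂ) : Prop := riemannZeta ρ = 0 ∧ θ < ρ.re ∧ ρ.re < 1

/-- The set of zeros beyond `θ`. -/
def zerosBeyond (θ : ℝ) : Set ℂ := {ρ | ZeroBeyond θ ρ}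

/-- WORLD «attained maximum»: some zero beyond `θ` has maximal real part among all zeros beyond `θ`. -/
def AttainedMax (θ : ℝ) : Prop := ∃ ρ₀ : ℂ, ZeroBeyond θ ρ₀ ∧ ∀ ρ : ℂ, ZeroBeyond θ ρ → ρ.re ≤ ρ₀.re

/-- WORLD «creeping maximum»: zeros beyond `θ` exist and every one is beaten by another. -/
def CreepingMax (θ : ℝ) : Prop :=
  (∃ ρ : ℂ, ZeroBeyond θ ρ) ∧ ∀ ρ₀ : ℂ, ZeroBeyond θ ρ₀ → ∃ ρ : ℂ, ZeroBeyond θ ρ ∧ ρ₀.re < ρ.re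

/-- `SupAttained θ` = quasi-RH(θ) OR an attained maximum (rev 3.2's first naming; see `WildBad` for the
residual that the pencil actually needs). -/
def SupAttained (θ : ℝ) : Prop := QuasiRiemannHypothesis θ ∨ AttainedMax θ

/-- WORLD «TAME bad»: zeros beyond `θ` exist, and beyond some `θ' ≥ θ` there are only FINITELY many (but
some). This is the world in which the Landau–MV comparison is a proof on pencil (isolated top patterns). -/
def TameBad (θ : ℝ) : Prop :=
  ∃ θ' : ℝ, θ ≤ θ' ∧ (zerosBeyond θ').Nonempty ∧ (zerosBeyond θ').Finite

/-- WORLD «WILD bad»: zeros beyond `θ` exist and beyond EVERY `θ' ≥ θ` that has any, there are infinitely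
many — the residual world in which Landau–MV necessity AND sign-selection arguments are silent. -/
def WildBad (θ : ℝ) : Prop :=
  (zerosBeyond θ).Nonempty ∧ ∀ θ' : ℝ, θ ≤ θ' → (zerosBeyond θ').Nonempty → (zerosBeyond θ').Infinite

/-- The R⋆-clause at all large scales, ONE-SIDED (what an «eventually» bookkeeping of the signed R⋆ consumes). -/
def ClauseEventually (r : ℝ → ℝ) : Prop := ∀ ε : ℝ, 0 < ε → ∀ᶠ N : ℝ in atTop, r N ≤ ε

/-- The R⋆-clause at all large scales in ABSOLUTE VALUE (what a `|·|`-bookkeeping of R⋆ consumes). -/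
def ClauseEventuallyAbs (r : ℝ → ℝ) : Prop := ∀ ε : ℝ, 0 < ε → ∀ᶠ N : ℝ in atTop, |r N| ≤ ε

/-- The R⋆-clause at infinitely many scales, one-sided (what the `_io` heart consumes). -/
def ClauseIO (r : ℝ → ℝ) : Prop := ∀ ε : ℝ, 0 < ε → ∃ᶠ N : ℝ in atTop, r N ≤ ε

/-! ## World logic (PROVED) -/

/-- `QuasiRiemannHypothesis θ` IS «no zero beyond `θ`» (definitional unfolding of the tree's strip form). -/
theorem quasiRH_iff_not_exists_zeroBeyond (θ : ℝ) :
    QuasiRiemannHypothesis θ ↔ ¬ ∃ ρ : ℂ, ZeroBeyond θ ρ := by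
  constructor
  · rintro h ⟨ρ, h0, h1, h2⟩
    exact h ρ h0 h1 h2
  · intro h s h0 h1 h2
    exact h ⟨s, h0, h1, h2⟩

/-- `¬ SupAttained θ ↔ CreepingMax θ`. -/
theorem not_supAttained_iff_creepingMax (θ : ℝ) : ¬ SupAttained θ ↔ CreepingMax θ := by
  unfold SupAttained CreepingMax AttainedMax
  rw [quasiRH_iff_not_exists_zeroBeyond]
  push Not
  exact Iff.rfl

/-- Monotonicity of «beyond»: a zero beyond `θ' ≥ θ` is beyond `θ`. -/
theorem ZeroBeyond.mono {θ θ' : ℝ} {ρ : ℂ} (hle : θ ≤ θ') (h : ZeroBeyond θ' ρ) : ZeroBeyond θ ρ :=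
  ⟨h.1, lt_of_le_of_lt hle h.2.1, h.2.2⟩

/-- TRICHOTOMY (PROVED): every world is quasi-RH(θ), tame bad, or wild bad. -/
theorem quasiRH_or_tameBad_or_wildBad (θ : ℝ) :
    QuasiRiemannHypothesis θ ∨ TameBad θ ∨ WildBad θ := by
  by_cases hq : QuasiRiemannHypothesis θ
  · exact Or.inl hq
  · right
    rw [quasiRH_iff_not_exists_zeroBeyond, not_not] at hq
    by_cases ht : TameBad θ
    · exact Or.inl ht
    · refine Or.inr ⟨hq, fun θ' hle hne => ?_⟩
      intro hfin
      exact ht ⟨θ', hle, hne, hfin⟩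

/-- Tame and wild are EXCLUSIVE (PROVED). -/
theorem not_wildBad_of_tameBad {θ : ℝ} (ht : TameBad θ) : ¬ WildBad θ := by
  rintro ⟨-, hw⟩
  obtain ⟨θ', hle, hne, hfin⟩ := ht
  exact (hw θ' hle hne) hfin

/-- A tame bad world refutes quasi-RH(θ) (PROVED). -/
theorem not_quasiRH_of_tameBad {θ : ℝ} (ht : TameBad θ) : ¬ QuasiRiemannHypothesis θ := by
  rw [quasiRH_iff_not_exists_zeroBeyond, not_not]
  obtain ⟨θ', hle, ⟨ρ, hρ⟩, -⟩ := ht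
  exact ⟨ρ, hρ.mono hle⟩

/-- A wild bad world refutes quasi-RH(θ) (PROVED). -/
theorem not_quasiRH_of_wildBad {θ : ℝ} (hw : WildBad θ) : ¬ QuasiRiemannHypothesis θ := by
  rw [quasiRH_iff_not_exists_zeroBeyond, not_not]
  obtain ⟨⟨ρ, hρ⟩, -⟩ := hw
  exact ⟨ρ, hρ⟩

/-- A tame bad world has an ATTAINED worst zero (PROVED: maximum of `re` over a finite nonempty set). -/
theorem attainedMax_of_tameBad {θ : ℝ} (ht : TameBad θ) : AttainedMax θ := by
  obtain ⟨θ', hle, hne, hfin⟩ := ht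
  obtain ⟨ρ₀, hρ₀, hmax⟩ := Set.exists_max_image (zerosBeyond θ') (fun ρ : ℂ => ρ.re) hfin hne
  refine ⟨ρ₀, ZeroBeyond.mono hle hρ₀, fun ρ hρ => ?_⟩
  by_cases hlt : θ' < ρ.re
  · exact hmax ρ ⟨hρ.1, hlt, hρ.2.2⟩
  · exact le_trans (not_lt.mp hlt) (le_of_lt hρ₀.2.1)

/-- A creeping supremum is WILD (PROVED; the converse fails: attained-but-accumulating is wild, not creeping —
so `WildBad` ⊋ `CreepingMax` is the honest residual). -/
theorem wildBad_of_creepingMax {θ : ℝ} (hc : CreepingMax θ) : WildBad θ := by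
  obtain ⟨hex, hcr⟩ := hc
  refine ⟨hex, fun θ' hle hne hfin => ?_⟩
  obtain ⟨ρ₀, hρ₀, hmax⟩ := Set.exists_max_image (zerosBeyond θ') (fun ρ : ℂ => ρ.re) hfin hne
  obtain ⟨ρ, hρ, hlt⟩ := hcr ρ₀ (ZeroBeyond.mono hle hρ₀)
  have hρ' : ρ ∈ zerosBeyond θ' := ⟨hρ.1, lt_trans hρ₀.2.1 hlt, hρ.2.2⟩
  exact absurd (hmax ρ hρ') (not_le.mpr hlt)

/-- Not wild ⇒ `SupAttained` (PROVED): the funded side of the trichotomy. -/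
theorem supAttained_of_not_wildBad {θ : ℝ} (h : ¬ WildBad θ) : SupAttained θ := by
  rcases quasiRH_or_tameBad_or_wildBad θ with hq | ht | hw
  · exact Or.inl hq
  · exact Or.inr (attainedMax_of_tameBad ht)
  · exact absurd hw h

/-! ## Clause bookkeeping (PROVED from the analytic INPUTS as hypotheses) -/

/-- Bookkeeping: an «eventually» clause implies the «i.o.» clause (LANDING NOTE: docstring added by the typer). -/
theorem ClauseEventually.clauseIO {r : ℝ → ℝ} (h : ClauseEventually r) : ClauseIO r :=
  fun ε hε => (h ε hε).frequently

/-- Bookkeeping: the absolute-value «eventually» clause implies the signed one (LANDING NOTE: docstring added by the typer). -/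
theorem ClauseEventuallyAbs.clauseEventually {r : ℝ → ℝ} (h : ClauseEventuallyAbs r) :
    ClauseEventually r :=
  fun ε hε => (h ε hε).mono fun N hN => le_trans (le_abs_self (r N)) hN

/-- **§R (NO-direction, typed): the i.o. R⋆-clause is funded in every NON-WILD world.**
`hSuff` = lens-5 sufficiency; `hSign` = Landau–MV Ω₋ comparison in a tame bad world (sign selection). -/
theorem clauseIO_of_not_wildBad {θ : ℝ} {r : ℝ → ℝ}
    (hSuff : QuasiRiemannHypothesis θ → ClauseEventually r)
    (hSign : TameBad θ → ∃ᶠ N : ℝ in atTop, r N < 0)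
    (h : ¬ WildBad θ) : ClauseIO r := by
  rcases quasiRH_or_tameBad_or_wildBad θ with hq | ht | hw
  · exact (hSuff hq).clauseIO
  · intro ε hε
    exact (hSign ht).mono fun N hN => le_of_lt (lt_trans hN hε)
  · exact absurd hw h

/-- **The residual world, typed:** if the i.o. clause FAILS although both inputs hold, the world is WILD. -/
theorem wildBad_of_not_clauseIO {θ : ℝ} {r : ℝ → ℝ}
    (hSuff : QuasiRiemannHypothesis θ → ClauseEventually r)
    (hSign : TameBad θ → ∃ᶠ N : ℝ in atTop, r N < 0)
    (hfail : ¬ ClauseIO r) : WildBad θ := by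
  by_contra hw
  exact hfail (clauseIO_of_not_wildBad hSuff hSign hw)

/-- **§R (YES-direction, one-sided, typed):** the «eventually» clause is REFUTED in every tame bad world
(`hOmegaPlus` = MV Thm 15.3 / (15.11) shape: an attained isolated worst zero forces `r N > ε₀` i.o.). Hence an
eventual one-sided bookkeeping of the signed R⋆ forces quasi-RH(θ) OR a wild world. -/
theorem quasiRH_or_wildBad_of_clauseEventually {θ : ℝ} {r : ℝ → ℝ}
    (hOmegaPlus : TameBad θ → ∃ ε₀ : ℝ, 0 < ε₀ ∧ ∃ᶠ N : ℝ in atTop, ε₀ < r N)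
    (hc : ClauseEventually r) : QuasiRiemannHypothesis θ ∨ WildBad θ := by
  rcases quasiRH_or_tameBad_or_wildBad θ with hq | ht | hw
  · exact Or.inl hq
  · obtain ⟨ε₀, hε₀, hfreq⟩ := hOmegaPlus ht
    exact absurd ((hc ε₀ hε₀).mono fun N hN => not_lt.mpr hN) hfreq
  · exact Or.inr hw

/-- **§R (YES-direction, absolute value, typed):** a `|·|`-bookkeeping of R⋆ at all large scales forces
quasi-RH(θ) OR a wild world (`hOmegaAbs` = the elementary Ω input: absolute convergence of the Mellin
transform vs an isolated pattern pole, MV Thm 15.2 shape, no sign information). This is the barrier-THEOREM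
shape of W-R⋆ for that bookkeeping class, with the wild world as the named gap of the necessity proof. -/
theorem quasiRH_or_wildBad_of_clauseEventuallyAbs {θ : ℝ} {r : ℝ → ℝ}
    (hOmegaAbs : TameBad θ → ∃ ε₀ : ℝ, 0 < ε₀ ∧ ∃ᶠ N : ℝ in atTop, ε₀ < |r N|)
    (hc : ClauseEventuallyAbs r) : QuasiRiemannHypothesis θ ∨ WildBad θ := by
  rcases quasiRH_or_tameBad_or_wildBad θ with hq | ht | hw
  · exact Or.inl hq
  · obtain ⟨ε₀, hε₀, hfreq⟩ := hOmegaAbs ht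
    exact absurd ((hc ε₀ hε₀).mono fun N hN => not_lt.mpr hN) hfreq
  · exact Or.inr hw

/-- If in addition the wild world is excluded by a further input (e.g. a mean-square / almost-periodicity
argument, NOT claimed on pencil), the eventual `|·|`-clause forces quasi-RH(θ) outright. -/
theorem quasiRH_of_clauseEventuallyAbs {θ : ℝ} {r : ℝ → ℝ}
    (hOmegaAbs : TameBad θ → ∃ ε₀ : ℝ, 0 < ε₀ ∧ ∃ᶠ N : ℝ in atTop, ε₀ < |r N|)
    (hWild : WildBad θ → ∃ ε₀ : ℝ, 0 < ε₀ ∧ ∃ᶠ N : ℝ in atTop, ε₀ < |r N|)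
    (hc : ClauseEventuallyAbs r) : QuasiRiemannHypothesis θ := by
  rcases quasiRH_or_wildBad_of_clauseEventuallyAbs hOmegaAbs hc with hq | hw
  · exact hq
  · obtain ⟨ε₀, hε₀, hfreq⟩ := hWild hw
    exact absurd ((hc ε₀ hε₀).mono fun N hN => not_lt.mpr hN) hfreq

/-- Link to the tree's barrier record (bookkeeping): in the quasi-RH(θ) world the i.o. zero-free BOXES of any
height exponent `κ > 0` are available (`fundingBoxIO_iff_quasiRH`) — §R's funded world W0 is the barrier's
funded world; §R's tame bad world W1 funds the i.o. clause by SIGN, outside the barrier's box currency. -/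
theorem fundingBoxIO_of_quasiRH {θ κ : ℝ} (hκ : 0 < κ) (h : QuasiRiemannHypothesis θ) :
    Literature.Barriers.Parity.FundingBoxIO θ κ :=
  (Literature.Barriers.Parity.fundingBoxIO_iff_quasiRH hκ).2 h

end Summit.Parity.GeneralizedHardyLittlewood.Theorems.PrimeLevelFamEdgeIdeaDeltas.RStarDichotomy
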